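import Summits.BirchSwinnertonDyer.BirchSwinnertonDyer.Theses.KolyvaginRoadThree
import Literature.NumberTheory.EllipticCurves.QuadraticTwistLocalDataAtTwoHoldsProofs
import HarnessLib

/-!
# Route `KolyvaginRoadThree`: the item `BarriosEtAlTamagawaTwistAtTwo` CLOSED by name — its Literature constant is a tree THEOREM

Item stmt-BirchSwinnertonDyer-19401 (support; the same ledger item is `ClassRecordThree.BarriosEtAlTamagawaTwistAtTwo`) of route `KolyvaginRoadThree` is, by name, the Literature constant behind
`Summit.BirchSwinnertonDyer.BirchSwinnertonDyer.Theses.KolyvaginRoadThree.BarriosEtAlTamagawaTwistAtTwo` (Barrios et al. 2025 Thm. 5.1: the local Tamagawa number at `2` of a quadratic twist of a curve with good reduction at `2`). That named fact is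
DISCHARGED in the tree: `Literature.NumberTheory.EllipticCurves.BarriosEtAl2025.localTamagawaNumber_quadraticTwist_two_mem_of_goodReduction_holds`
(module `Literature.NumberTheory.EllipticCurves.QuadraticTwistLocalDataAtTwoHoldsProofs`). This file only restates that theorem at the FULLY-QUALIFIED item type, so the
ledger item closes `proved`; nothing is asserted, no hypothesis, no new declaration besides the
alias theorem.

Honest framing: closes ONE cite-only published-input item of a route of `BirchSwinnertonDyer` by
name; no crux; no label or count of any partition moves; BSD is proved for no curve by this file.
Prepared by cell `bsd-eis`, seat `bsd-eis-k5-ty` g14 (literature-prover / typer; BSD-wide scan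
«open item whose Literature constant already has a `_holds`»), for a PROVER of the owning cell to
file. [cite: BarriosEtAl2025, Thm. 5.1 with Tables tab:localdata-dodd / tab:localdata-deven, rows R = I₀ (arXiv:2501.03209 pp. 15–16)]
-/

set_option autoImplicit false
set_option linter.dupNamespace false

namespace Summit.BirchSwinnertonDyer.BirchSwinnertonDyer.Theorems

/-- **Item `KolyvaginRoadThree.BarriosEtAlTamagawaTwistAtTwo` holds**, by the Literature theorem
`Literature.NumberTheory.EllipticCurves.BarriosEtAl2025.localTamagawaNumber_quadraticTwist_two_mem_of_goodReduction_holds`. [cite: BarriosEtAl2025, Thm. 5.1 with Tables tab:localdata-dodd / tab:localdata-deven, rows R = I₀ (arXiv:2501.03209 pp. 15–16)] -/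
theorem kolyvaginRoadThree_barriosEtAlTamagawaTwistAtTwo_holds :
    Summit.BirchSwinnertonDyer.BirchSwinnertonDyer.Theses.KolyvaginRoadThree.BarriosEtAlTamagawaTwistAtTwo :=
  Literature.NumberTheory.EllipticCurves.BarriosEtAl2025.localTamagawaNumber_quadraticTwist_two_mem_of_goodReduction_holds

end Summit.BirchSwinnertonDyer.BirchSwinnertonDyer.Theorems
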